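import Literature.AlgebraicGeometry.Resolution.PointBlowupHeight

/-!
# Hauser–Perlega's flag invariant `(d, n, s)` for purely inseparable surfaces (statement-level typing)

H. Hauser, S. Perlega, *Resolving surface singularities in positive characteristic*, Publ. RIMS Kyoto Univ. **60**
(2024) 767–813 [cite: HauserPerlega2024] (= the surface part of S. Perlega's thesis, arXiv:2011.14443) prove
embedded resolution of two-dimensional hypersurfaces `X ⊂ W` over an algebraically closed field of characteristic
`p > 0` by point blow-ups steered by a local invariant.  For a purely inseparable equation `f = z^{p^e} + F(x,y)`,
`ord F > p^e`, `F` CLEAN (no `p^e`-th power monomials), with exceptional divisor `E_a ∈ {∅, V(x), V(xy)}`: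

* §3 (p. 775) TERMINAL CASES, in a regular system of parameters subordinate to `E_a`: the monomial case
  "`F = x^{r_x} y^{r_y}·u` where `(r_x, r_y) ∉ p^e·ℕ²` and `u` is a unit … if `E_a = ∅` we require that either
  `r_x = 0` or `r_y = 0`", and the small residual case "`F = y^{k p^e}·g` where `k` is a positive integer and
  `0 < ord g < p^e`";
* §4 (p. 776) the RESIDUAL ORDER: "`F = M·G` where `M` is the unique monomial of maximal degree supported on `E_a`
  that divides `F`.  The order of `G` is called the residual order … `d_res = ord G = ord F − ord_{E_a} F`";
* §5 (pp. 782–784) FLAGS `𝓕 : F₂ ⊇ F₁` at `a` ADAPTED to `X` and `E` (`F₂` has normal crossings with `E_a`, either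
  `F₁ ⊆ E_a` or `F₁ ∪ E_a` has normal crossings, and `f = z^{p^e} + F(x,y)` is clean in parameters SUBORDINATE to
  `𝓕`, i.e. `F₂ = V(z)`, `F₁ = V(z,y)`), and the FLAG INVARIANT `inv^𝓕_a(X) = (d_𝓕, n_𝓕, s_𝓕)`:
  (i) `n_𝓕 = 0` ("`E_a = ∅`, or `F₂ ∩ E_a` has just one component and `F₁` meets this component transversally, or
  `F₁` equals a component"): `d_𝓕 = d_res` and, in parameters subordinate to both `𝓕` and `E_a`, with `F = M·G`,
  "`s_𝓕 = ord coeff^{d}(G)` if `d ≥ p^e` or `d = 0`, `s_𝓕 = ord coeff^{(p^e−d)d}(M^d + G^{p^e−d})` if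
  `0 < d < p^e`", where "`coeff^c(H) = (H_i^{c!/(c−i)}, i < c) ⊆ K[[x]]` for `H = Σ H_i(x) y^i`";
  (ii) `n_𝓕 ≥ 1` (`F₁` tangent to a component of `F₂ ∩ E_a` with intersection multiplicity `n_𝓕`, or — `n_𝓕 = 1` —
  transversal to both components): with `ω(x) = 1`, `ω(y) = n_𝓕`, "`d^curv_𝓕 = ord_{F₁} in_ω(F)`" and
  "`d_𝓕 = 0` if `0 < d^curv_𝓕 < p^e` and `p^e` divides `ord_ω(F)`, `d_𝓕 = d^curv_𝓕` otherwise", `s_𝓕 = 0`;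
  `(d, n, s) = max_𝓕 (d_𝓕, n_𝓕, s_𝓕)` (lexicographic; a maximising flag exists off the terminal cases, Prop. 3);
* Prop. 4 (p. 793): under a point blow-up `π : W' → W` with centre `a` and `a' ∈ π⁻¹(a)` with `ord_{a'} X' =
  ord_a X`, if `X'` is not in a terminal case at `a'` then `inv_{a'}(X') < inv_a(X)` — the core result; Lemmas 1–2
  (pp. 788–789) bound `d_𝓕 ≤ d_res + p^{e−1}` for the flags of case (ii).

This file TYPES these notions over the `MvPolynomial`/`MvPowerSeries` model of the atlas (`PointBlowup.State`,
cleaned `F`, exceptional letters = the support of the multiplicity vector `r`), in the dictionary of the atlas (D10,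
a recorded CONVENTION, not a theorem of this file): a flag is presented by a TRIANGULAR datum `(curve letter φ,
other letter ψ, h ∈ K[[ψ]], h(0) = 0)`, `F₁ = V(z₁, φ + h(ψ))`, subordinate parameters `(x₁, y₁) = (ψ, φ + h(ψ))`, so
that the expansion of `F` in them is `HauserWagner2014.substFree ψ φ (−h) F` and `z₁` is the cleaning; the three
`n = 0` configurations are `φ ∈ E_a → h = 0` (a transversal flag through the unique component `V(φ)` is written
with curve letter `ψ`), the case-(ii) flags are `φ ∈ E_a`, `ord h = n ≥ 2`, or `n = 1` with both letters
exceptional.  The coefficient ideal of case `0 < d < p^e` is read as the COMPANION IDEAL `coeff^c((M^d) +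
(G^{p^e−d}))` of [cite: Perlega2020, §3.8 (arXiv p. 41)] (an ideal sum; `coeff^c` of an ideal is generated by the
powers of the coefficients of its generators, [cite: Perlega2020, §7.2 (arXiv p. 24)]) — the order of a sum of two principal coefficient ideals in the discrete valuation
ring `K[[x₁]]` is the minimum of the two orders; the literal power-series sum `M^d + G^{p^e−d}` printed on p. 783 is
typed alongside (`sValueSeries`) for comparison by the atlas.  Terminal cases are typed in GIVEN subordinate
parameters and up to triangular changes (`IsTerminalSub`); [HP24] allow any subordinate regular system.
DEFINITIONS and NAMED PROPOSITIONS only: Prop. 4 and Lemmas 1–2 are recorded as `FlagInvariantDropsStatement`,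
`TangentFlagBoundStatement`, NOT asserted; nothing printed is claimed as a Lean theorem here.  The computable twin
with kernel-checked rows is `KangarooAtlasCertFlagInvariant`.
-/

noncomputable section

open MvPolynomial Finset
open scoped Classical

namespace Literature.AlgebraicGeometry.Resolution

open Literature.AlgebraicGeometry.Resolution.Hauser2010
open Literature.AlgebraicGeometry.Resolution.PointBlowup
open Literature.AlgebraicGeometry.Resolution.HauserWagner2014

namespace HauserPerlega2024

variable {σ : Type*} {K : Type*} [Field K]

/-! ### Power-series bookkeeping: support orders, cleaning, monomial division, weighted initial part -/

/-- the order of a power series along the ideal `(x_y)`: the least exponent of `x_y` in its support (`⊤` for `0`);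
"`ord_{F₁}`" for `F₁ = V(z, y)`. [cite: HauserPerlega2024, §5 p. 784 (ord_{F₁} in_ω(F))] -/
def ordAlong (y : σ) (H : MvPowerSeries σ K) : ℕ∞ := ⨅ (d : σ →₀ ℕ) (_ : H d ≠ 0), ((d y : ℕ) : ℕ∞)

/-- the order at the origin of the row `H_i(x) = Σ_a [x^a y^i] H · x^a` of the expansion `H = Σ H_i(x) y^i` (two
letters `x, y`; `⊤` if the row vanishes). [cite: HauserPerlega2024, §5 p. 783 (H = Σ H_i(x) y^i)] -/
def rowOrder (x y : σ) (H : MvPowerSeries σ K) (i : ℕ) : ℕ∞ :=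
  ⨅ (a : ℕ) (_ : H (Finsupp.single x a + Finsupp.single y i) ≠ 0), ((a : ℕ) : ℕ∞)

/-- "`coeff^c(H) = (H_i^{c!/(c−i)}, i < c) ⊆ K[[x]]`": its ORDER, `min_{i<c} (c!/(c−i))·ord H_i` (`K[[x]]` is a discrete
valuation ring, so the order of the ideal is the least order of a generator). [cite: HauserPerlega2024, §5 p. 783 (coeff^c)] -/
def coeffIdealOrder (c : ℕ) (x y : σ) (H : MvPowerSeries σ K) : ℕ∞ :=
  ⨅ i ∈ Finset.range c, ((c.factorial / (c - i) : ℕ) : ℕ∞) * rowOrder x y H i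

/-- removal of the `q`-th power monomials of a power series (the cleaning `z ↦ z₁` over a perfect field, applied to
an expansion in new parameters). [cite: HauserPerlega2024, §5 p. 783 (clean expansion)] -/
def cleanSeries (q : ℕ) (H : MvPowerSeries σ K) : MvPowerSeries σ K :=
  fun d => if ∀ i, q ∣ d i then 0 else H d

/-- division by the monomial `x^m` on the level of coefficients (`(H / x^m)_d = H_{d+m}`; exact when `x^m ∣ H`).
[cite: HauserPerlega2024, §4 p. 776 (F = M·G)] -/
def divMonomial (m : σ →₀ ℕ) (H : MvPowerSeries σ K) : MvPowerSeries σ K := fun d => H (d + m)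

/-- the weighted order `ord_ω(H)` for weights `ω`. [cite: HauserPerlega2024, §5 p. 784 (ord_ω)] -/
def wOrder (ω : σ → ℕ) (H : MvPowerSeries σ K) : ℕ∞ := H.weightedOrder ω

/-- the weighted initial form `in_ω(H)`: the part of `H` of weight `ord_ω(H)`. [cite: HauserPerlega2024, §5 p. 784 (in_ω(F))] -/
def initialPart (ω : σ → ℕ) (H : MvPowerSeries σ K) : MvPowerSeries σ K :=
  fun d => if ((Finsupp.weight ω d : ℕ) : ℕ∞) = wOrder ω H then H d else 0

/-! ### §3 — terminal cases (given subordinate parameters) -/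

/-- MONOMIAL CASE in the given parameters: "`F = x^{r_x} y^{r_y}·u` where `(r_x, r_y) ∉ p^e·ℕ²` and `u` is a unit …
if `E_a = ∅` we require that either `r_x = 0` or `r_y = 0`" (`E` = the set of exceptional letters through the point).
[cite: HauserPerlega2024, §3 p. 775] -/
def IsMonomialCase (q : ℕ) (E : Finset σ) (H : MvPowerSeries σ K) : Prop :=
  ∃ (m : σ →₀ ℕ) (u : MvPowerSeries σ K), H = MvPowerSeries.monomial m 1 * u ∧ MvPowerSeries.constantCoeff u ≠ 0 ∧
    ¬ (∀ i, q ∣ m i) ∧ (E = ∅ → ∃ i, m i = 0)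

/-- SMALL RESIDUAL CASE in the given parameters: "`F = y^{k p^e}·g` where `k` is a positive integer and `g` a power
series of order `0 < ord g < p^e`" (after possibly swapping the letters). [cite: HauserPerlega2024, §3 p. 775] -/
def IsSmallResidualCase (q : ℕ) (H : MvPowerSeries σ K) : Prop :=
  ∃ (y : σ) (k : ℕ) (g : MvPowerSeries σ K), 0 < k ∧ H = MvPowerSeries.X y ^ (k * q) * g ∧ 0 < g.order ∧ g.order < q

/-- terminal case in the given parameters: monomial or small residual. [cite: HauserPerlega2024, §3 p. 775] -/
def IsTerminalGiven (q : ℕ) (E : Finset σ) (H : MvPowerSeries σ K) : Prop :=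
  IsMonomialCase q E H ∨ IsSmallResidualCase q H

/-! ### §4 — exceptional monomial and residual order (given parameters subordinate to `E_a`) -/

/-- the exceptional letters through the point of a walk state: the support of the multiplicity vector `r`
(dictionary D10: `E_a = ⋃_{r_i > 0} V(y_i)`). [cite: HauserPerlega2024, §4 p. 776 (E_a defined by x, y, or xy)] -/
def excLetters (s : State σ K) : Finset σ := s.r.support

/-- the exponent of "the unique monomial `M` of maximal degree supported on `E_a` that divides `F`":
`i ↦ ord_{y_i} F` for `i ∈ E`, `0` otherwise. [cite: HauserPerlega2024, §4 p. 776] -/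
def excExponent (E : Finset σ) (F : MvPolynomial σ K) : σ →₀ ℕ := ∑ i ∈ E, Finsupp.single i (ordVar F i)

/-- "`d_res = ord G = ord F − ord_{E_a} F`" (for a cleaned `F ≠ 0`). [cite: HauserPerlega2024, §4 p. 776] -/
def dRes (E : Finset σ) (F : MvPolynomial σ K) : ℕ := (ordZero F).toNat - ∑ i ∈ E, ordVar F i

/-! ### §5 — flags in triangular presentation and the flag invariant -/

/-- a flag `𝓕 : F₂ ⊇ F₁` at the point, presented triangularly: `F₁ = V(z₁, y_curve + h(y_other))` with `h(0) = 0`, the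
subordinate parameters being `(x₁, y₁) = (y_other, y_curve + h(y_other))` and `z₁` the cleaning (dictionary D10).
[cite: HauserPerlega2024, §5 pp. 782–783 (flags adapted to X and E; subordinate parameters)] -/
structure FlagDatum (σ : Type*) (K : Type*) [Field K] where
  /-- the letter `φ` whose shift cuts out the curve `F₁` -/
  curve : σ
  /-- the other letter `ψ` (`x₁ = ψ` generates `𝒪_{F₁}`) -/
  other : σ
  /-- the shift: `F₁ = V(z₁, φ + h(ψ))`, `h(0) = 0` -/
  h : PowerSeries K

namespace FlagDatum

variable (Φ : FlagDatum σ K)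

/-- well-formedness: two distinct letters and `h(0) = 0`. [cite: HauserPerlega2024, §5 p. 782] -/
def WF : Prop := Φ.curve ≠ Φ.other ∧ PowerSeries.constantCoeff Φ.h = 0

/-- case (i), `n_𝓕 = 0`: "`E_a = ∅`, or `F₂ ∩ E_a` has just one component and `F₁` meets this component transversally, or
`F₁` equals a component of `F₂ ∩ E_a`" — in the triangular presentation with parameters subordinate to BOTH `𝓕` and
`E_a`: the curve letter is exceptional only for `h = 0` (D10). [cite: HauserPerlega2024, §5 p. 783 (i)] -/
def IsCaseN0 (E : Finset σ) : Prop := Φ.WF ∧ (Φ.curve ∈ E → Φ.h = 0)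

/-- case (ii), `n_𝓕 = n ≥ 1`: `F₁` is tangent to the component `V(y_curve)` of `E_a` with intersection multiplicity
`n = ord h ≥ 2`, or (`n = 1`) both letters are exceptional and `F₁ = V(z₁, φ + h(ψ))`, `ord h = 1`, is transversal to
both components. [cite: HauserPerlega2024, §5 p. 784 (ii)] -/
def IsCaseTangent (E : Finset σ) (n : ℕ) : Prop :=
  Φ.WF ∧ Φ.curve ∈ E ∧ Φ.h.order = n ∧ (2 ≤ n ∨ (n = 1 ∧ Φ.other ∈ E))

/-- the weights of case (ii): `ω(x₁) = 1`, `ω(y₁) = n_𝓕` (letters other than the two are given weight `1`).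
[cite: HauserPerlega2024, §5 p. 784] -/
def weights (n : ℕ) : σ → ℕ := fun i => if i = Φ.curve then n else 1

variable [DecidableEq σ]

/-- the expansion of `F` in the subordinate parameters `(x₁, y₁) = (ψ, φ + h(ψ))`: `F(ψ ↦ x₁, φ ↦ y₁ − h(x₁))`, i.e.
`HauserWagner2014.substFree ψ φ (−h) F`, followed by the cleaning. [cite: HauserPerlega2024, §5 p. 783 (f = z^{p^e} + F(x,y), F clean, in subordinate parameters)] -/
def expansion (q : ℕ) (F : MvPolynomial σ K) : MvPowerSeries σ K := cleanSeries q (substFree Φ.other Φ.curve (-Φ.h) F)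

end FlagDatum

variable [DecidableEq σ]

/-- case (i): the residual factor `G` of the expansion in parameters subordinate to `𝓕` and `E_a` (`F = M·G`, `M` the
exceptional monomial, whose exponent is unchanged by an admissible triangular change). [cite: HauserPerlega2024, §5 p. 783 (F = M·G)] -/
def residualFlat (q : ℕ) (E : Finset σ) (Φ : FlagDatum σ K) (F : MvPolynomial σ K) : MvPowerSeries σ K :=
  divMonomial (excExponent E F) (Φ.expansion q F)

/-- case (i): `s_𝓕` — "`ord coeff^{d}(G)` if `d ≥ p^e` or `d = 0`; `ord coeff^{(p^e−d)d}((M^d) + (G^{p^e−d}))` if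
`0 < d < p^e`" with the companion ideal read as an IDEAL sum ([cite: Perlega2020, §3.8 (arXiv p. 41)]): the minimum of the
orders of the two coefficient ideals. (`⊤` = `∞` occurs exactly when a generator row vanishes, e.g. in a hidden monomial case.)
[cite: HauserPerlega2024, §5 p. 783 (s_𝓕)] -/
def sValue (q : ℕ) (E : Finset σ) (Φ : FlagDatum σ K) (F : MvPolynomial σ K) : ℕ∞ :=
  let d := dRes E F
  let G := residualFlat q E Φ F
  let M : MvPowerSeries σ K := MvPowerSeries.monomial (excExponent E F) 1
  if q ≤ d ∨ d = 0 then coeffIdealOrder d Φ.other Φ.curve G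
  else min (coeffIdealOrder ((q - d) * d) Φ.other Φ.curve (M ^ d))
    (coeffIdealOrder ((q - d) * d) Φ.other Φ.curve (G ^ (q - d)))

/-- the LITERAL reading of p. 783 for `0 < d < p^e`: the coefficient ideal of the power series `M^d + G^{p^e−d}` (typed for
comparison; it can differ from `sValue` when rows of the two summands cancel or align). [cite: HauserPerlega2024, §5 p. 783 (s_𝓕, printed formula)] -/
def sValueSeries (q : ℕ) (E : Finset σ) (Φ : FlagDatum σ K) (F : MvPolynomial σ K) : ℕ∞ :=
  let d := dRes E F
  let G := residualFlat q E Φ F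
  let M : MvPowerSeries σ K := MvPowerSeries.monomial (excExponent E F) 1
  if q ≤ d ∨ d = 0 then coeffIdealOrder d Φ.other Φ.curve G
  else coeffIdealOrder ((q - d) * d) Φ.other Φ.curve (M ^ d + G ^ (q - d))

/-- case (ii): "`d^curv_𝓕 = ord_{F₁} in_ω(F)`", the order along `F₁ = V(z₁, y₁)` of the weighted initial form of the clean
expansion, `ω(x₁) = 1`, `ω(y₁) = n`. [cite: HauserPerlega2024, §5 p. 784 (d^curv_𝓕)] -/
def dCurv (q : ℕ) (Φ : FlagDatum σ K) (n : ℕ) (F : MvPolynomial σ K) : ℕ∞ :=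
  ordAlong Φ.curve (initialPart (Φ.weights n) (Φ.expansion q F))

/-- case (ii): "`d_𝓕 = 0` if `0 < d^curv_𝓕 < p^e` and `p^e` divides `ord_ω(F)`, `d_𝓕 = d^curv_𝓕` otherwise" (as a natural
number; the expansion of a non-zero clean `F` is non-zero). [cite: HauserPerlega2024, §5 p. 784 (d_𝓕)] -/
def dFlag (q : ℕ) (Φ : FlagDatum σ K) (n : ℕ) (F : MvPolynomial σ K) : ℕ :=
  let dc := (dCurv q Φ n F).toNat
  let w := (wOrder (Φ.weights n) (Φ.expansion q F)).toNat
  if 0 < dc ∧ dc < q ∧ q ∣ w then 0 else dc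

/-- the value type of the flag invariant `(d_𝓕, n_𝓕, s_𝓕)` with the lexicographic order (`s` in `ℕ∞`).
[cite: HauserPerlega2024, §5 p. 783 (inv^𝓕_a(X) = (d_𝓕, n_𝓕, s_𝓕))] -/
abbrev Triple : Type := ℕ ×ₗ ℕ ×ₗ ℕ∞

/-- `inv^𝓕_a(X) = (d_res, 0, s_𝓕)` for a flag of case (i). [cite: HauserPerlega2024, §5 p. 784 (first case)] -/
def invCaseN0 (q : ℕ) (E : Finset σ) (Φ : FlagDatum σ K) (F : MvPolynomial σ K) : Triple :=
  toLex (dRes E F, toLex (0, sValue q E Φ F))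

/-- `inv^𝓕_a(X) = (d_𝓕, n_𝓕, 0)` for a flag of case (ii). [cite: HauserPerlega2024, §5 p. 784 (second case)] -/
def invCaseTangent (q : ℕ) (Φ : FlagDatum σ K) (n : ℕ) (F : MvPolynomial σ K) : Triple :=
  toLex (dFlag q Φ n F, toLex (n, (0 : ℕ∞)))

/-- the set of flag invariants over all adapted flags (triangular presentation). [cite: HauserPerlega2024, §5 p. 784 ((d,n,s) = max over 𝓕 ∈ F)] -/
def flagValues (q : ℕ) (E : Finset σ) (F : MvPolynomial σ K) : Set Triple :=
  {v | ∃ Φ : FlagDatum σ K, Φ.IsCaseN0 E ∧ v = invCaseN0 q E Φ F} ∪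
    {v | ∃ (Φ : FlagDatum σ K) (n : ℕ), Φ.IsCaseTangent E n ∧ v = invCaseTangent q Φ n F}

/-- "`(d, n, s) = max_{𝓕 ∈ F} (d_𝓕, n_𝓕, s_𝓕)`": `v` IS the flag invariant of `(F, E)` — the greatest element of `flagValues`
(its existence off the terminal cases is [HP24, Prop. 3], not asserted here). [cite: HauserPerlega2024, §5 p. 784] -/
def IsFlagInvariant (q : ℕ) (E : Finset σ) (F : MvPolynomial σ K) (v : Triple) : Prop :=
  IsGreatest (flagValues q E F) v

/-- terminal case up to a triangular change of parameters subordinate to `E_a` (the clean expansion in the new parameters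
is in the monomial or the small residual case); [HP24] quantify over all subordinate regular systems of parameters.
[cite: HauserPerlega2024, §3 p. 775 (there exists a regular system of parameters … subordinate to E_a)] -/
def IsTerminalSub (q : ℕ) (E : Finset σ) (F : MvPolynomial σ K) : Prop :=
  ∃ Φ : FlagDatum σ K, Φ.IsCaseN0 E ∧ IsTerminalGiven q E (Φ.expansion q F)

/-! ### Edge statements (named, NOT asserted) -/

/-- [HP24, Prop. 4] for purely inseparable surfaces, in the atlas model: along a point blow-up at an equimultiple point
(`PointBlowup.step`, exceptional letters = support of `r`), if neither end is in a terminal case then the flag invariant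
drops strictly in the lexicographic order.  A NAMED PROPOSITION recording the printed statement under the dictionary D10
(cleaned `F`, `ord F > q = p^e`, `K` algebraically closed); it is NOT asserted. [cite: HauserPerlega2024, Prop. 4 p. 793] -/
def FlagInvariantDropsStatement (p e : ℕ) (K : Type*) [Field K] [CharP K p] [IsAlgClosed K] [DecidableEq K] : Prop :=
  ∀ (s : State (Fin 2) K) (j : Fin 2) (b : Fin 2 → K) (v v' : Triple),
    s.F ≠ 0 → deletePthPowers (p ^ e) s.F = s.F → ((p ^ e : ℕ) : ℕ∞) < ordZero s.F → IsEquimultiplePoint (p ^ e) j b s →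
    ¬ IsTerminalSub (p ^ e) (excLetters s) s.F →
    ¬ IsTerminalSub (p ^ e) (excLetters (step (p ^ e) j b s)) (step (p ^ e) j b s).F →
    IsFlagInvariant (p ^ e) (excLetters s) s.F v →
    IsFlagInvariant (p ^ e) (excLetters (step (p ^ e) j b s)) (step (p ^ e) j b s).F v' → v' < v

/-- [HP24, Prop. 3] — EXISTENCE OF A MAXIMIZING FLAG (the existence clause only; NOT asserted).  "Proposition 3. There
exists a maximizing flag `𝓕 ∈ F` with `inv^𝓕_a(X) ∈ ℕ³` and `d_𝓕 > 0`", under the standing local setting of [HP24] §7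
p. 788: "`f = z^{p^e} + F(x, y)` where `ord F > p^e` and the expansion of `F(x, y)` is clean … the normal crossings
divisor `E_a` … `E_a ⊆ V(xy)` … We always assume in the following that `X` is not in a terminal case at `a`."  In the
dictionary D10 of this file: for a two-letter state `s` over an algebraically closed field with `s.F ≠ 0` cleaned, of
order `> p^e`, and `(s.F, E_a = supp s.r)` not terminal up to a subordinate triangular change (`IsTerminalSub`), the set
of flag values has a greatest element (`IsFlagInvariant`).  Only the EXISTENCE clause is recorded (it is all the
well-founded descent on `Triple` uses); the printed statement adds `inv ∈ ℕ³` and `d_𝓕 > 0`.  A NAMED PROPOSITION, used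
as a hypothesis (typed by the decomp-res lens-5 g24 node «PlanarPort», §3). [cite: HauserPerlega2024, Prop. 3 p. 791] -/
def MaximizingFlagExistsStatement (p e : ℕ) (K : Type*) [Field K] [CharP K p] [IsAlgClosed K] : Prop :=
  ∀ s : State (Fin 2) K, s.F ≠ 0 → deletePthPowers (p ^ e) s.F = s.F → ((p ^ e : ℕ) : ℕ∞) < ordZero s.F →
    ¬ IsTerminalSub (p ^ e) (excLetters s) s.F → ∃ v : Triple, IsFlagInvariant (p ^ e) (excLetters s) s.F v

/-- [HP24, Lemmas 1–2]: for a flag of case (ii) (`n_𝓕 = 1` with two exceptional components, or tangent with multiplicity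
`n ≥ 2`), `d_𝓕 ≤ d_res + p^{e−1}` (Moh-type bound).  NAMED PROPOSITION, NOT asserted. [cite: HauserPerlega2024, Lemma 1 p. 788, Lemma 2 p. 789] -/
def TangentFlagBoundStatement (p e : ℕ) (K : Type*) [Field K] [CharP K p] [IsAlgClosed K] : Prop :=
  ∀ (E : Finset (Fin 2)) (F : MvPolynomial (Fin 2) K) (Φ : FlagDatum (Fin 2) K) (n : ℕ),
    F ≠ 0 → deletePthPowers (p ^ e) F = F → ((p ^ e : ℕ) : ℕ∞) < ordZero F → Φ.IsCaseTangent E n →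
    dFlag (p ^ e) Φ n F ≤ dRes E F + p ^ (e - 1)

/-! ### Sanity lemmas on the typed objects -/

/-- the residual order of the given parameters enters case (i) as the first component. [cite: HauserPerlega2024, §5 p. 783 (d_𝓕 = d_res)] -/
theorem invCaseN0_fst (q : ℕ) (E : Finset σ) (Φ : FlagDatum σ K) (F : MvPolynomial σ K) :
    (ofLex (invCaseN0 q E Φ F)).1 = dRes E F := rfl

/-- case (ii) carries the trivial third component `s_𝓕 = 0`. [cite: HauserPerlega2024, §5 p. 784 (s_𝓕 = 0)] -/
theorem invCaseTangent_snd_snd (q : ℕ) (Φ : FlagDatum σ K) (n : ℕ) (F : MvPolynomial σ K) :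
    (ofLex (ofLex (invCaseTangent q Φ n F)).2).2 = 0 := rfl

omit [DecidableEq σ] in
/-- with no exceptional letter the exceptional monomial is trivial and `d_res = ord F`. [cite: HauserPerlega2024, §4 p. 776] -/
theorem dRes_empty (F : MvPolynomial σ K) : dRes (∅ : Finset σ) F = (ordZero F).toNat := by
  simp [dRes]

omit [DecidableEq σ] in
/-- a flag of case (ii) never has `n = 0`. [cite: HauserPerlega2024, §5 p. 784 (n_𝓕 ≥ 1)] -/
theorem FlagDatum.IsCaseTangent.pos {E : Finset σ} {Φ : FlagDatum σ K} {n : ℕ} (h : Φ.IsCaseTangent E n) : 0 < n := by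
  rcases h with ⟨_, _, _, h2 | ⟨h1, _⟩⟩ <;> omega

end HauserPerlega2024

end Literature.AlgebraicGeometry.Resolution
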